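import Mathlib.LinearAlgebra.BilinearForm.Orthogonal
import Mathlib.LinearAlgebra.Matrix.BilinearForm
import Mathlib.LinearAlgebra.Matrix.Block
import Mathlib.LinearAlgebra.Matrix.Determinant.Basic
import Mathlib.LinearAlgebra.FiniteDimensional.Lemmas
import Mathlib.Algebra.BigOperators.Group.Finset.Basic
import Mathlib.Algebra.Polynomial.Derivative
import Mathlib.Tactic.Linarith
import Mathlib.Tactic.Ring
import Mathlib.Tactic.FieldSimp
import Mathlib.Tactic.NormNum
import Mathlib.Tactic.LinearCombination
import HarnessLib

/-!
# Prym–Torelli at `|H| ≥ 3`: the ι-transfer and the jet pairing — kernel skeleton (WEIL-2 gen 45, TRANSFER-G45, fact-free)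

research route, not a corollary; conditional on HC_CM plus one named minimal statement.

Cell `pub-hodge-ring2-ab-*` (ALL ABELIAN VARIETIES), seat WEIL-2 gen 45, account
`run/shared/lean/pub/pub-hodge-ring2/pub-hodge-ring2-ab-weil-2/TRANSFER-G45.md`.

Informal setting (PRYM-G42 §1, CLIFFORD-G44 §1, TRANSFER-G45 §1–§2).  For a Galois–Prym datum `G = ℤ/f ⋊ H` over `ℙ¹`
(`H = ker χ_K` abelian, `C' = C/N`, `π : C' → ℙ¹` an `H`-cover) the codifferential of the `K`-piece period map is
`V ⊗ V_Δ → T = H⁰(2K'+B')^H`, `g ⊗ g' ↦ Tr_H(g g')`.  TRANSFER-G45 proves: (ι-transfer) if an involution `ι ∈ H` has `2g'+2` fixed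
points then `Tr_H = p ∘ Tr_ι` with `p` onto, so a full ι-image stays full (`map_eq_top_of_surjective` below) and CLIFFORD-G44's
THEOREMS H/H′/H″ transfer; (jets) at a branch point of index `e` the trace is a non-degenerate jet pairing whose blocks are
anti-triangular Hankel matrices (`det_ne_zero_of_antitriangular`, `antitriangular_nondegenerate`), the branch-point costs add up to
`2n + 2|H|` (`cost_split`, `total_cost`), and for `s = 2` the isotropy bound plus Clifford leaves only even `d ≥ 0` with both bundles
extremal (`window_s2`, `clifford_parity`; `clifford_squeeze_two` of CLIFFORD-G44).  `support_table_s2` is the finite check that for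
every cost pattern of the 369 `s = 2` data the three dearest branch points cost at least `2|H| + 1`, and `maxima_residue_arithmetic`
the residue arithmetic of the four maxima chases of §3.3 (ℚ(√−15), ℚ(√−5), ℚ(√−6), ℚ(√−2)).

0 sorry, no `def`, no named fact; `HC_CM` does not occur.
-/

namespace Summit.HodgeConjecture.Ring2AbelianAll.PrymTorelliTransfer

section transfer

variable {F : Type*} [Field F] {Tι T : Type*} [AddCommGroup Tι] [Module F Tι] [AddCommGroup T] [Module F T]

/-- LEMMA 1.2 (ι-transfer), linear-algebra core: if `I_ι = T_ι` (the ι-pairing is onto) and `p : T_ι → T` is onto (the sum over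
`H/⟨ι⟩`), then `I_H = p(I_ι) = T`.  [TRANSFER-G45 §1.2]
research route, not a corollary; conditional on HC_CM plus one named minimal statement. -/
theorem map_eq_top_of_surjective (p : Tι →ₗ[F] T) (hp : Function.Surjective p) (I : Submodule F Tι) (hI : I = ⊤) :
    I.map p = ⊤ := by
  subst hI
  rw [Submodule.map_top]
  exact LinearMap.range_eq_top.2 hp

/-- LEMMA 1.2 (ι-transfer), the form used: «deficient for `H` ⟹ deficient for `ι`», i.e. `p(I_ι) ≠ T ⟹ I_ι ≠ T_ι`.
[TRANSFER-G45 §1.2]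
research route, not a corollary; conditional on HC_CM plus one named minimal statement. -/
theorem ne_top_of_map_ne_top (p : Tι →ₗ[F] T) (hp : Function.Surjective p) (I : Submodule F Tι) (h : I.map p ≠ ⊤) :
    I ≠ ⊤ := fun hI => h (map_eq_top_of_surjective p hp I hI)

end transfer

section jets

variable {F : Type*} [Field F]

/-- LEMMA Λ_H (jet blocks), determinant form: a square matrix over a field which vanishes strictly below the anti-diagonal
(`M a j = 0` whenever `a + j ≥ n`) and is non-zero on the anti-diagonal (`a + j = n − 1`) has non-zero determinant — the Hankel blocks
`(c_{i₁+j₁})` (resp. `(c_{i₁+j₁+1})`) of the jet pairing, `c_ℓ = 0` for `ℓ ≥ μ`, `c_{μ−1} ≠ 0`.  [TRANSFER-G45 §2.2]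
research route, not a corollary; conditional on HC_CM plus one named minimal statement. -/
theorem det_ne_zero_of_antitriangular {n : ℕ} (M : Matrix (Fin n) (Fin n) F)
    (hz : ∀ a j : Fin n, n ≤ a.val + j.val → M a j = 0) (hd : ∀ a j : Fin n, a.val + j.val + 1 = n → M a j ≠ 0) :
    M.det ≠ 0 := by
  -- reverse the rows: M' i j = M (rev i) j is lower triangular with non-zero diagonal
  have hBT : (M.submatrix (Fin.revPerm : Equiv.Perm (Fin n)) id).BlockTriangular OrderDual.toDual := by
    intro i j hij
    have hij' : i < j := hij
    simp only [Matrix.submatrix_apply, id]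
    apply hz
    have h1 : ((Fin.revPerm : Equiv.Perm (Fin n)) i).val = n - (i.val + 1) := by
      simp [Fin.revPerm_apply, Fin.val_rev]
    have h2 : i.val < j.val := hij'
    omega
  have hdet' : (M.submatrix (Fin.revPerm : Equiv.Perm (Fin n)) id).det =
      ∏ i : Fin n, (M.submatrix (Fin.revPerm : Equiv.Perm (Fin n)) id) i i :=
    Matrix.det_of_lowerTriangular _ hBT
  have hprod : ∏ i : Fin n, (M.submatrix (Fin.revPerm : Equiv.Perm (Fin n)) id) i i ≠ 0 := by
    rw [Finset.prod_ne_zero_iff]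
    intro i _
    simp only [Matrix.submatrix_apply, id]
    apply hd
    have h1 : ((Fin.revPerm : Equiv.Perm (Fin n)) i).val = n - (i.val + 1) := by
      simp [Fin.revPerm_apply, Fin.val_rev]
    have := i.isLt
    omega
  have hperm := Matrix.det_permute (Fin.revPerm : Equiv.Perm (Fin n)) M
  intro hM
  rw [hM, mul_zero] at hperm
  exact hprod (hdet' ▸ hperm)

/-- LEMMA Λ_H (jet blocks), bilinear form: the pairing `(u, v) ↦ uᵀ M v` of an anti-triangular matrix with non-zero anti-diagonal is
non-degenerate (so the isotropy bound `finrank_add_le_of_eval_orthogonal` of CLIFFORD-G44 applies to the jet pairing).  [TRANSFER-G45 §2.2]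
research route, not a corollary; conditional on HC_CM plus one named minimal statement. -/
theorem antitriangular_nondegenerate {n : ℕ} (M : Matrix (Fin n) (Fin n) F)
    (hz : ∀ a j : Fin n, n ≤ a.val + j.val → M a j = 0) (hd : ∀ a j : Fin n, a.val + j.val + 1 = n → M a j ≠ 0) :
    (Matrix.toBilin' M).Nondegenerate :=
  LinearMap.BilinForm.nondegenerate_toBilin'_of_det_ne_zero' M (det_ne_zero_of_antitriangular M hz hd)

end jets

section costs

/-- The cost of a branch point of index `e` with `|H|/e` points over it and `m ∈ {0,1}`: `(|H|/e)(e − 1 + m) = (|H| − |H|/e) + m·|H|/e`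
— the Riemann–Hurwitz contribution plus the `B'`-contribution.  [TRANSFER-G45 §2.3]
research route, not a corollary; conditional on HC_CM plus one named minimal statement. -/
theorem cost_split (hs e m : ℚ) (he : e ≠ 0) : (hs / e) * (e - 1 + m) = (hs - hs / e) + m * (hs / e) := by
  have : hs / e * e = hs := div_mul_cancel₀ hs he
  linear_combination this

/-- The cost identity: with `2g' − 2 = −2|H| + Σ_y (|H| − |H|/e_y)` (Riemann–Hurwitz; `N`-type points have `e = 1`), `2s = Σ_y m_y |H|/e_y`
(balance; `N`-type points have `m = 1`) and `2n = (2g' − 2) + 2s` (i.e. `n = g' − 1 + s`):  **`Σ_y cost(y) = 2n + 2|H|`**.  [TRANSFER-G45 §2.3]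
research route, not a corollary; conditional on HC_CM plus one named minimal statement. -/
theorem total_cost {r : ℕ} (hs : ℚ) (e m : Fin r → ℚ) (he : ∀ i, e i ≠ 0) (g2 s2 n2 : ℚ)
    (hRH : g2 = -2 * hs + ∑ i, (hs - hs / e i)) (hbal : s2 = ∑ i, m i * (hs / e i)) (hn : n2 = g2 + s2) :
    ∑ i, (hs / e i) * (e i - 1 + m i) = n2 + 2 * hs := by
  have hc : ∀ i, (hs / e i) * (e i - 1 + m i) = (hs - hs / e i) + m i * (hs / e i) := fun i => cost_split hs (e i) (m i) (he i)
  rw [Finset.sum_congr rfl fun i _ => hc i, Finset.sum_add_distrib, hn, hRH, hbal]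
  ring

/-- THEOREM J2, the degree window for `s = 2`: `dim V = dim V_Δ = g'+1`, support cost `deg Z ≤ 2g'+1`, isotropy
`h + h' + deg Z ≥ 2g' + 2`; `deg Z = 2g'+1` would force `h = h' = 0` (degree `−1`), absurd; hence `d = 2g' − deg Z ≥ 0` and `h + h' ≥ d + 2`.
[TRANSFER-G45 §2.4]
research route, not a corollary; conditional on HC_CM plus one named minimal statement. -/
theorem window_s2 (g degZ h h' : ℕ) (hZ : degZ ≤ 2 * g + 1) (hΛ : 2 * g + 2 ≤ h + h' + degZ)
    (hvan : degZ = 2 * g + 1 → h = 0 ∧ h' = 0) : degZ ≤ 2 * g ∧ (2 * g - degZ) + 2 ≤ h + h' := by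
  refine ⟨?_, ?_⟩
  · by_contra hc
    have := hvan (by omega)
    omega
  · by_cases hc : degZ = 2 * g + 1
    · have := hvan hc; omega
    · omega

/-- THEOREM J2, parity: Clifford's bound `h⁰(D) ≤ ⌊deg D/2⌋ + 1` for both bundles of ODD degree `d` contradicts `h + h' ≥ d + 2` — the
«odd cost» exclusions (e.g. all of `C₃ (3,1)⁴`, `C₆ (6,0)(3,1)²(2,0)`).  [TRANSFER-G45 §2.4, §2.6 (a)]
research route, not a corollary; conditional on HC_CM plus one named minimal statement. -/
theorem clifford_parity (h h' d : ℕ) (hodd : d % 2 = 1) (hc : 2 * h ≤ d + 1) (hc' : 2 * h' ≤ d + 1) (hΛ : d + 2 ≤ h + h') :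
    False := by omega

/-- LEMMA S / §3.1: for every cost pattern (sorted costs, `n`, `|H|`, `g'`) occurring among the 369 `s = 2` boundary data at `f ≥ 15`
over `ℙ¹` the costs add up to `2n + 2|H|` and the complement of the three dearest points costs at most `2g' + 1` (so THEOREM J2's window
applies off every triple containing them, and — all other points being cheaper — off any triple).  [TRANSFER-G45 §2.3–2.4, §3.1]
research route, not a corollary; conditional on HC_CM plus one named minimal statement. -/
theorem support_table_s2 :
    ((3 + 3 + 3 + 3 : ℕ) = 2 * 3 + 2 * 3 ∧ ((3 + 3 + 3 + 3 : ℕ) - (3 + 3 + 3) ≤ 2 * 2 + 1)) ∧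
    ((3 + 3 + 3 + 3 + 2 : ℕ) = 2 * 4 + 2 * 3 ∧ ((3 + 3 + 3 + 3 + 2 : ℕ) - (3 + 3 + 3) ≤ 2 * 3 + 1)) ∧
    ((4 + 3 + 3 + 2 : ℕ) = 2 * 2 + 2 * 4 ∧ ((4 + 3 + 3 + 2 : ℕ) - (4 + 3 + 3) ≤ 2 * 1 + 1)) ∧
    ((4 + 3 + 3 + 2 + 2 : ℕ) = 2 * 3 + 2 * 4 ∧ ((4 + 3 + 3 + 2 + 2 : ℕ) - (4 + 3 + 3) ≤ 2 * 2 + 1)) ∧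
    ((4 + 3 + 3 + 2 + 2 + 2 : ℕ) = 2 * 4 + 2 * 4 ∧ ((4 + 3 + 3 + 2 + 2 + 2 : ℕ) - (4 + 3 + 3) ≤ 2 * 3 + 1)) ∧
    ((4 + 3 + 3 + 3 + 3 : ℕ) = 2 * 4 + 2 * 4 ∧ ((4 + 3 + 3 + 3 + 3 : ℕ) - (4 + 3 + 3) ≤ 2 * 3 + 1)) ∧
    ((4 + 4 + 2 + 2 : ℕ) = 2 * 2 + 2 * 4 ∧ ((4 + 4 + 2 + 2 : ℕ) - (4 + 4 + 2) ≤ 2 * 1 + 1)) ∧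
    ((4 + 4 + 2 + 2 + 2 : ℕ) = 2 * 3 + 2 * 4 ∧ ((4 + 4 + 2 + 2 + 2 : ℕ) - (4 + 4 + 2) ≤ 2 * 2 + 1)) ∧
    ((4 + 4 + 2 + 2 + 2 + 2 : ℕ) = 2 * 4 + 2 * 4 ∧ ((4 + 4 + 2 + 2 + 2 + 2 : ℕ) - (4 + 4 + 2) ≤ 2 * 3 + 1)) ∧
    ((4 + 4 + 3 + 3 : ℕ) = 2 * 3 + 2 * 4 ∧ ((4 + 4 + 3 + 3 : ℕ) - (4 + 4 + 3) ≤ 2 * 2 + 1)) ∧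
    ((4 + 4 + 3 + 3 + 2 : ℕ) = 2 * 4 + 2 * 4 ∧ ((4 + 4 + 3 + 3 + 2 : ℕ) - (4 + 4 + 3) ≤ 2 * 3 + 1)) ∧
    ((4 + 4 + 4 + 2 : ℕ) = 2 * 3 + 2 * 4 ∧ ((4 + 4 + 4 + 2 : ℕ) - (4 + 4 + 4) ≤ 2 * 2 + 1)) ∧
    ((4 + 4 + 4 + 2 + 2 : ℕ) = 2 * 4 + 2 * 4 ∧ ((4 + 4 + 4 + 2 + 2 : ℕ) - (4 + 4 + 4) ≤ 2 * 3 + 1)) ∧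
    ((6 + 6 + 3 + 3 : ℕ) = 2 * 3 + 2 * 6 ∧ ((6 + 6 + 3 + 3 : ℕ) - (6 + 6 + 3) ≤ 2 * 2 + 1)) ∧
    ((6 + 6 + 5 + 3 : ℕ) = 2 * 4 + 2 * 6 ∧ ((6 + 6 + 5 + 3 : ℕ) - (6 + 6 + 5) ≤ 2 * 3 + 1)) ∧
    ((8 + 6 + 6 + 4 : ℕ) = 2 * 4 + 2 * 8 ∧ ((8 + 6 + 6 + 4 : ℕ) - (8 + 6 + 6) ≤ 2 * 3 + 1)) ∧
    ((8 + 8 + 4 + 4 : ℕ) = 2 * 4 + 2 * 8 ∧ ((8 + 8 + 4 + 4 : ℕ) - (8 + 8 + 4) ≤ 2 * 3 + 1)) := by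
  decide

end costs

section maxima

/-- §3.3, the residue arithmetic of the four maxima chases.
ℚ(√−15), `f = 15`, `H = {1,2,4,8}`, `ι = 4` (`4² ≡ 1`), `N`-residues `5a mod 15 = 5,10,5,10` summing to `15·2`, ι-pairs `(1,4), (2,8)`, `T'_ι`-coefficients
`(r_{4a} − 4r_a)/15 = −1,−2,−1,−2`, `e = gcd(15, 1+4) = 5` odd with `5 = 1·15 − 2·5`, and `δ/5 − 3D^h`: `1 + 1 = 2·1`, `2 + 2 = 2·2`, `1 + 2 = 3`.
ℚ(√−5), `f = 20`, `H = {1,3,7,9}`, `ι = 9`, residues `5a mod 20 = 5,15,15,5`, pairs `(1,9),(3,7)`, `e = gcd(20,10) = 10` even, `f/5 = 4` even, `δ/5` pair sums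
`1+1 + (3+3)·1 = … = 4 = f/5` per `D^h`.  ℚ(√−6), `f = 24`, `H = {1,5,7,11}`, `ι = 7`, `M`-residues `8, 16` (`1·(1+7)`, `5·8 mod 24`), both `≡ 0 (4)`,
`f ≡ 0 (4)`: `Δ/2 = 4w + 8w' − 12D₀` has even coefficients throughout.  ℚ(√−2), `f = 40`: `9² ≡ 1 (40)` and the fixed-point count `2 + 2 + 4 = 2·3 + 2`.
[TRANSFER-G45 §3.3]
research route, not a corollary; conditional on HC_CM plus one named minimal statement. -/
theorem maxima_residue_arithmetic :
    -- Q(sqrt -15), f = 15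
    ((4 : ℕ) * 4 % 15 = 1 ∧ 5 * 1 % 15 = 5 ∧ 5 * 2 % 15 = 10 ∧ 5 * 4 % 15 = 5 ∧ 5 * 8 % 15 = 10 ∧ 5 + 10 + 5 + 10 = 15 * 2 ∧
      1 * 4 % 15 = 4 ∧ 2 * 4 % 15 = 8 ∧ ((5 : ℤ) - 4 * 5) / 15 = -1 ∧ ((10 : ℤ) - 4 * 10) / 15 = -2 ∧
      Nat.gcd 15 (1 + 4) = 5 ∧ 5 % 2 = 1 ∧ (1 : ℤ) * 15 - 2 * 5 = 5 ∧ 5 / 5 + 5 / 5 = 2 * 1 ∧ 10 / 5 + 10 / 5 = 2 * 2 ∧ 1 + 2 = 15 / 5) ∧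
    -- Q(sqrt -5), f = 20
    (9 * 9 % 20 = 1 ∧ 5 * 1 % 20 = 5 ∧ 5 * 3 % 20 = 15 ∧ 5 * 7 % 20 = 15 ∧ 5 * 9 % 20 = 5 ∧ 5 + 15 + 15 + 5 = 20 * 2 ∧
      1 * 9 % 20 = 9 ∧ 3 * 9 % 20 = 7 ∧ Nat.gcd 20 (1 + 9) = 10 ∧ 10 % 2 = 0 ∧ (20 / 5) % 2 = 0 ∧ 5 / 5 + 15 / 5 = 20 / 5) ∧
    -- Q(sqrt -6), f = 24
    (7 * 7 % 24 = 1 ∧ 1 * (1 + 7) % 24 = 8 ∧ 5 * 8 % 24 = 16 ∧ 8 + 16 = 24 * 1 ∧ 8 % 4 = 0 ∧ 16 % 4 = 0 ∧ 24 % 4 = 0) ∧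
    -- Q(sqrt -2), f = 40
    (9 * 9 % 40 = 1 ∧ 2 + 2 + 4 = 2 * 3 + 2) := by
  refine ⟨?_, ?_, ?_, ?_⟩ <;> norm_num

end maxima

section lambda
/-! ### Appendix (v2, same gen): THEOREM H_Λ — the identities behind `Λ_S ∘ ᾱ = Λ_{ζS}` (TRANSFER-G45 §1.6) -/

open Polynomial

/-- THEOREM H_Λ (c), the derivative identity: if `f(ζx) = f(x)` (the Weierstrass polynomial is invariant under the generator `x ↦ ζx` of
`H/⟨ι⟩`), then `ζ·f'(ζx) = f'(x)` as polynomials; evaluated at a root `r` this is `1/f'(r)·(value at ζr) = 1/f'(ζr)·(…)`, i.e.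
`Λ_S∘ᾱ = Λ_{ζS}` for `Λ_S = Σ_{r∈S} ev_r/f'(r)`.  [TRANSFER-G45 §1.6 (c)]
research route, not a corollary; conditional on HC_CM plus one named minimal statement. -/
theorem derivative_of_comp_C_mul_X_eq {K : Type*} [Field K] (f : K[X]) (ζ : K) (h : f.comp (C ζ * X) = f) :
    C ζ * (derivative f).comp (C ζ * X) = derivative f := by
  have := congrArg derivative h
  rw [Polynomial.derivative_comp] at this
  simpa [Polynomial.derivative_C_mul, Polynomial.derivative_X] using this

/-- THEOREM H_Λ (c), evaluated form: `f(ζx) = f(x)` ⟹ `ζ · f'(ζ r) = f'(r)` for every `r`.  [TRANSFER-G45 §1.6 (c)]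
research route, not a corollary; conditional on HC_CM plus one named minimal statement. -/
theorem deriv_eval_mul_eq {K : Type*} [Field K] (f : K[X]) (ζ r : K) (h : f.comp (C ζ * X) = f) :
    ζ * (derivative f).eval (ζ * r) = (derivative f).eval r := by
  have key := congrArg (Polynomial.eval r) (derivative_of_comp_C_mul_X_eq f ζ h)
  simpa [Polynomial.eval_mul, Polynomial.eval_comp, Polynomial.eval_C, Polynomial.eval_X] using key

/-- THEOREM H_Λ (d)/(e) and the `C₂×C₂` case, the parity identities: an EVEN polynomial (`f(−x) = f(x)`) has an ODD derivative,
`f'(−r) = −f'(r)` (so `1/f'` changes sign under `r ↦ −r`: `Λ_S∘σ̄ = −Λ_{−S}` up to the action's own sign), and an ODD polynomial has an EVEN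
derivative, `f'(−r) = f'(r)`.  [TRANSFER-G45 §1.6 (c)–(e)]
research route, not a corollary; conditional on HC_CM plus one named minimal statement. -/
theorem deriv_eval_neg_of_even_or_odd {K : Type*} [Field K] (f : K[X]) (r : K) :
    (f.comp (-X) = f → (derivative f).eval (-r) = -(derivative f).eval r) ∧
    (f.comp (-X) = -f → (derivative f).eval (-r) = (derivative f).eval r) := by
  have hc : ∀ g : K[X], (derivative (g.comp (-X))).eval r = -((derivative g).eval (-r)) := by
    intro g
    rw [Polynomial.derivative_comp]
    simp [Polynomial.eval_comp, Polynomial.eval_neg, Polynomial.eval_X]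
  refine ⟨fun h => ?_, fun h => ?_⟩
  · have := hc f
    rw [h] at this
    linear_combination this
  · have := hc f
    rw [h, Polynomial.derivative_neg, Polynomial.eval_neg] at this
    linear_combination this

/-- THEOREM H_Λ, the orbit-union count for the `C₆`-data `(3,1)²(2,0)²` at `f = 36` (TRANSFER-G45 §1.6, CONSEQUENCE): `W` is two `H/ι`-orbits of size 3, and no
union of orbits other than `∅`, `W` has even size (`3` and `3` are odd, `0` and `6` are the excluded ones) — so there is no `H`-deficient class at all; for
the `C₄×C₂`-data (two orbits of size 4) exactly one class (one orbit, `4` even) and for `C₂×C₂` at `g' = 1, 3` (orbits of size 2: `2, 4` orbits) `1` resp. `7`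
classes modulo complement.  [TRANSFER-G45 §1.6]
research route, not a corollary; conditional on HC_CM plus one named minimal statement. -/
theorem orbit_union_counts :
    (3 % 2 = 1 ∧ (3 + 3) % 2 = 0) ∧ (4 % 2 = 0 ∧ 2 ^ 2 / 2 - 1 = 1) ∧ (2 ^ 2 / 2 - 1 = 1 ∧ 2 ^ 4 / 2 - 1 = 7) := by
  decide

end lambda

end Summit.HodgeConjecture.Ring2AbelianAll.PrymTorelliTransfer
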